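import Summits.CriticalPhenomena.CardyFormulaZ2.Theorems.CardyFlipRussoVoronoiHubFromSmirnovVoidBall
import Summits.CriticalPhenomena.CardyFormulaZ2.Theorems.CardyFlipRussoVoronoiHubFromSmirnovGridNet

/-!
# Stub `poisson_voidNear_disc_le` of line `moebius-exact-delaunay-dilation-ward`
# (crux `VoronoiHubFromSmirnov`, stmt-CriticalPhenomena-6433)

"No giant cells" (I. Benjamini, O. Schramm, *Conformal invariance of Voronoi percolation*,
Comm. Math. Phys. 197 (1998) 75–107, Lemma 5.5) in the assembled form consumed by the Voronoi
arguments of the line: for a Poisson process `P` of Lebesgue intensity on `ℂ`, a set `A` inside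
the closed disc of radius `ρ` and a scale `0 < s ≤ 3ρ`, the probability that some point of `A` is
at distance `≥ s` from all nuclei is at most `(12ρ/s + 1)² · exp(-π (s/3)²)`.

Proof. Cover `A` by the open `(s/3)`-balls centred at a finite grid net `X` of the disc with
`|X| ≤ (4ρ/(s/3) + 1)² = (12ρ/s + 1)²` (`exists_finset_net_closedBall`), apply the void-ball
union bound `poisson_voidBall_unionBound` with this `X`, and compare the two constants.

No new definitions; tree facts and Mathlib only.
-/

noncomputable section

namespace Summit.CriticalPhenomena.CardyFormulaZ2.Cruxes.VoronoiHubFromSmirnov.MoebiusExactDelaunayDilationWard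

open MeasureTheory Literature.Analysis.FunctionSpaces

/-- The mesh constant at scale `s/3`: `4ρ/(s/3) = 12ρ/s`. -/
theorem vnd_four_mul_div_third (ρ s : ℝ) : 4 * ρ / (s / 3) = 12 * ρ / s := by
  rw [div_div_eq_mul_div]
  ring

/-- **No giant cells** (Benjamini–Schramm 1998, Lemma 5.5): for a Poisson process `P` of
Lebesgue intensity on `ℂ`, `A ⊆ closedBall 0 ρ` and `0 < s ≤ 3ρ`, the probability that some
`z ∈ A` has all nuclei at distance `≥ s` is at most `(12ρ/s + 1)² · exp(-π (s/3)²)`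
(grid net of mesh `s/3` and the void-ball union bound). -/
theorem poisson_voidNear_disc_le : ∀ {P : MeasureTheory.Measure (Literature.Analysis.FunctionSpaces.PointConfig ℂ)}, Literature.Analysis.FunctionSpaces.IsPoissonPointProcess (MeasureTheory.volume : MeasureTheory.Measure ℂ) P → ∀ (A : Set ℂ) (ρ s : ℝ), 0 < s → s ≤ 3 * ρ → A ⊆ Metric.closedBall 0 ρ → P.real {c | ∃ z ∈ A, ∀ q ∈ c, s ≤ dist q z} ≤ (12 * ρ / s + 1) ^ 2 * Real.exp (-(Real.pi * (s / 3) ^ 2)) := by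
  intro P hP A ρ s hs hsρ hA
  have hs3 : 0 < s / 3 := by positivity
  have hs3ρ : s / 3 ≤ ρ := by linarith
  obtain ⟨X, hcard, hAX⟩ := exists_finset_net_closedBall A (s / 3) ρ hs3 hs3ρ hA
  rw [vnd_four_mul_div_third] at hcard
  calc P.real {c | ∃ z ∈ A, ∀ q ∈ c, s ≤ dist q z}
      ≤ X.card * Real.exp (-(Real.pi * (s / 3) ^ 2)) :=
        poisson_voidBall_unionBound hP A X s hs hAX
    _ ≤ (12 * ρ / s + 1) ^ 2 * Real.exp (-(Real.pi * (s / 3) ^ 2)) :=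
        mul_le_mul_of_nonneg_right hcard (Real.exp_nonneg _)

end Summit.CriticalPhenomena.CardyFormulaZ2.Cruxes.VoronoiHubFromSmirnov.MoebiusExactDelaunayDilationWard

end
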